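import Summits.QuantumFields.BalabanUV.Beta.EriceFlowEnclosureB12AsPrintedHistoryContagionShiftEnd
import Summits.QuantumFields.BalabanUV.Beta.EriceFlowEnclosureB12AsPrintedPointwiseFadingSignWitness

/-!
# Beta / EriceFlowEnclosureB12AsPrintedHistoryContagionShiftWitness — ASYMPTOTIC FREEDOM IS CONTAGIOUS, part 8 (non-vacuity, sign-free): EVERY hypothesis of
# part 6's `continuumCoupling_of_typedTheorem2` — Theorem 2 AS TYPED, the printed `Definitions` (and `Conclusions`, `StandingHypotheses`), the binder `hrg`,
# NE4 `ScaleShiftRate`, coupling-chart `HistLipschitz` with `FadingMemory` at rate θ = ½ < 1 — is inhabited AT ONCE by prover 2's gen-44 RAMP SETTING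
# (β_2(g₀, g₁) = g₁(2g₁ − g₀), β_{k+1} ≡ 1 otherwise; genuinely history-dependent), on which the asymptotic-freedom letter of node U2's all-k booking
# `T4CouplingMatching.injectedRate_of_runs` is VOID (`¬ BetaLowerH b γ` for every b ≥ 0 and every box γ > 0: β_2 < 0 inside every box) and (0.31) admits no
# g-uniform constants — and there the continuum limit of Theorem 2's running coupling exists at every physical scale by part 6 (β-flow team, prover 1, unit
# `b2b-balaban-beta-bflow-p1`, gen 36; ROW AP-I·Uc × NODE U2; parts 5–7 `…HistoryContagionShift` ∕ `…ShiftEnd` ∕ `…ShiftOrder`)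

HONEST FRAMING (page 1 of everything the β sub-cell writes): discharging `BetaPertH` makes Bałaban's UV stability UNCONDITIONAL — a
real constructive-QFT result; it is NOT the continuum limit and NOT the Clay problem.  HONEST DEPENDENCY (cell reorg 2026-08-19,
verbatim): «continuum YM on T⁴ ⇐ BetaPertH ∧ nine spine estimates (0/9 proved); BetaPertH ⇐ (D1) ∧ (D4) ∧ CAP+tail; G-an2-4 gates
asym, D1 and NE2/3/4.»  THIS MODULE DISCHARGES NOTHING: the setting is a TOY of prover 2's lineage (`…PointwiseFadingSignWitness.rampToy_exists`, junk
carrier fields as in every as-printed toy), NOT Bałaban's β; the only new computation is the NE4 letter `ScaleShiftRate (7∕2) (1∕2) (1∕2)` for the ramp family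
(§8), the rest is a junction BY NAME (prover 2's `theorem2_typed_ramp`, `histLipschitz_ramp`, `fadingMemory_ramp`, `letters_ramp`, `not_betaSignH_ramp`,
`not_uniform_ramp`; part 6's `continuumCoupling_of_typedTheorem2`).  [I] = T. Bałaban, Commun. Math. Phys. **109** (1987) [Balaban1987RG1]; Theorem 2 is
STATED WITHOUT PROOF there (p. 259); every letter is a hypothesis SHAPE, here shown jointly inhabited — nothing is asserted about Bałaban's β.

WHAT THIS FILE PROVES (0 sorry, 0 def): §8 `scaleShiftRate_ramp` (NE4 for the ramp family: `|β_{k+2}(w) − β_{k+1}(tail w)| ≤ (7∕2)(½)^k` on ]0, ½]^{k+2}),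
**`continuumLimit_typed_nonvacuous_signFree`** (∃ an as-printed setting with `StandingHypotheses`, `Definitions`, `Conclusions`, `Theorem2Statement`, `hrg` on
]0, ½], `HistLipschitz Λ ½`, `FadingMemory 5 ½ Λ`, `ScaleShiftRate (7∕2) ½ ½`, `¬ BetaLowerH b γ` ∀ b ≥ 0 ∀ γ > 0, NO g-uniform (0.31) — AND the conclusion of
part 6's `continuumCoupling_of_typedTheorem2` on the box ]0, ½]: for every m, below some g₃ > 0 Theorem 2's tuned rows converge at every physical scale with
node U2's `InjectedRate (14) 0 ½`, the limit flow, the geometric tail and the two-sided logarithmic running in the continuum).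
NOT CLAIMED: anything about Bałaban's β; that node U2's EVENTUAL booking is void on this toy (it is not: β_{k+1} ≡ 1 for k ≥ 2 gives `EventualLowerH 1 γ 2`,
and its admission `5∕θ·(3γ³ + 2γ) ≤ (1−θ)∕2` holds on boxes γ ≲ 1∕80 — the two bookings overlap there); `BetaPertH`; continuum limit of the measures; Clay.
-/

namespace Summit.QuantumFields.BalabanUV.Beta.EriceFlowEnclosureB12AsPrintedHistoryContagionShiftWitness

open Finset Filter Topology
open Literature.MathematicalPhysics.QuantumFieldTheory.Balaban1983to89
open Literature.MathematicalPhysics.QuantumFieldTheory.Balaban1983to89.B12BetaAsPrinted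
open Literature.MathematicalPhysics.QuantumFieldTheory.Balaban1983to89.FlowStep (Box mem_box RGEqH BetaLowerH BetaSignH)
open Literature.MathematicalPhysics.QuantumFieldTheory.Balaban1983to89.T4CouplingMatching (HistLipschitz FadingMemory ScaleShiftRate disc)
open Literature.MathematicalPhysics.QuantumFieldTheory.Balaban1983to89.T4CauchySum (InjectedRate)
open Literature.MathematicalPhysics.QuantumFieldTheory.Balaban1983to89.T4ContinuumCoupling (astar gstar bstar)
open Summit.QuantumFields.BalabanUV.Beta.EriceFlowEnclosureB12AsPrintedPointwiseFadingSignFamily (beta_one beta_of_ne_one letters_ramp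
  histLipschitz_ramp fadingMemory_ramp not_betaSignH_ramp not_uniform_ramp theorem2_typed_ramp)
open Summit.QuantumFields.BalabanUV.Beta.EriceFlowEnclosureB12AsPrintedPointwiseFadingSignWitness (rampToy_exists)
open Summit.QuantumFields.BalabanUV.Beta.EriceFlowEnclosureB12AsPrintedHistoryContagionShiftEnd (continuumCoupling_of_typedTheorem2)

noncomputable section

/-! ## §8 NE4 for the ramp family, and the sign-free non-vacuity of the continuum limit -/

/-- **NE4 FOR THE RAMP FAMILY.**  For β_2(g₀, g₁) = g₁(2g₁ − g₀), β_{k+1} ≡ 1 (k ≠ 1): on ]0, ½]^{k+2}, `|β_{k+2}(w) − β_{k+1}(tail w)| ≤ (7∕2)(½)^k` — at k = 0 and k = 1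
the difference is `±(1 − g(2g − g′))` with |g(2g − g′)| ≤ ¾, from k = 2 on it vanishes. [folklore] -/
theorem scaleShiftRate_ramp {S : Setting}
    (hβ : ∀ (k : ℕ) (p : Fin (k + 1) → ℝ), S.β k p = if k = 1 then p (Fin.last k) * (2 * p (Fin.last k) - p 0) else 1) :
    ScaleShiftRate (7 / 2) (1 / 2) (1 / 2) S.β := by
  intro k w hw
  have hbd : ∀ (p : Fin (1 + 1) → ℝ), p ∈ Box (1 / 2) 1 → |p 1 * (2 * p 1 - p 0)| ≤ 3 / 4 := by
    intro p hp
    have h0 := (mem_box.mp hp) 0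
    have h1 := (mem_box.mp hp) 1
    rw [abs_le]
    constructor <;> nlinarith [h0.1, h0.2, h1.1, h1.2]
  rcases k with _ | _ | k
  · -- k = 0: β_2(w) − β_1(tail w) = w₁(2w₁ − w₀) − 1
    have e1 : S.β (0 + 1) w = w 1 * (2 * w 1 - w 0) := by rw [hβ]; simp
    have e0 : S.β 0 (Fin.tail w) = 1 := by rw [hβ]; simp
    rw [e1, e0]
    have h := hbd w hw
    have : |w 1 * (2 * w 1 - w 0) - 1| ≤ |w 1 * (2 * w 1 - w 0)| + 1 := by
      calc |w 1 * (2 * w 1 - w 0) - 1| ≤ |w 1 * (2 * w 1 - w 0)| + |(1 : ℝ)| := abs_sub _ _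
        _ = |w 1 * (2 * w 1 - w 0)| + 1 := by rw [abs_one]
    norm_num
    linarith
  · -- k = 1: β_3(w) − β_2(tail w) = 1 − t₁(2t₁ − t₀), t = tail w ∈ ]0, ½]²
    have e1 : S.β (1 + 1) w = 1 := by rw [hβ]; simp
    have ht : Fin.tail w ∈ Box (1 / 2) 1 := mem_box.mpr fun i => (mem_box.mp hw) i.succ
    have e0 : S.β 1 (Fin.tail w) = Fin.tail w 1 * (2 * Fin.tail w 1 - Fin.tail w 0) := by rw [hβ]; simp
    rw [e1, e0]
    have h := hbd (Fin.tail w) ht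
    rw [abs_sub_comm]
    have : |Fin.tail w 1 * (2 * Fin.tail w 1 - Fin.tail w 0) - 1| ≤ |Fin.tail w 1 * (2 * Fin.tail w 1 - Fin.tail w 0)| + 1 := by
      calc |Fin.tail w 1 * (2 * Fin.tail w 1 - Fin.tail w 0) - 1|
          ≤ |Fin.tail w 1 * (2 * Fin.tail w 1 - Fin.tail w 0)| + |(1 : ℝ)| := abs_sub _ _
        _ = |Fin.tail w 1 * (2 * Fin.tail w 1 - Fin.tail w 0)| + 1 := by rw [abs_one]
    norm_num
    linarith
  · -- k ≥ 2: both values are 1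
    have e1 : S.β (k + 2 + 1) w = 1 := by rw [hβ]; simp
    have e0 : S.β (k + 2) (Fin.tail w) = 1 := by rw [hβ]; simp
    rw [e1, e0, sub_self, abs_zero]
    positivity

/-- **THE CONTINUUM LIMIT OF THEOREM 2's RUNNING COUPLING ON A SIGN-FREE HISTORY-DEPENDENT SETTING — every binder inhabited at once.**  There is an as-printed setting
(prover 2's ramp setting: β_2(g₀, g₁) = g₁(2g₁ − g₀), β_{k+1} ≡ 1 otherwise, L = 13, box ½) carrying `StandingHypotheses`, `Definitions`, `Conclusions`, [I] THEOREM 2 AS TYPED,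
the binder `hrg` on ]0, ½], coupling-chart moduli `HistLipschitz Λ ½` with `FadingMemory 5 ½ Λ` (θ = ½ < 1), NE4 `ScaleShiftRate (7∕2) ½ ½` — on which the AF letter of node
U2's all-k booking is VOID (`¬ BetaLowerH b γ S.β` for EVERY b ≥ 0, γ > 0: β_2(δ, δ∕3) = −δ²∕9 < 0) and Theorem 2's (0.31) admits NO g-uniform constants — and on which, for every
torus exponent m, below some g₃ > 0 EVERY renormalized coupling g carries Theorem 2's tuned rows «g₀(ε, g)» whose effective couplings CONVERGE at every physical scale as
ε = L^{−K} → 0, with node U2's `InjectedRate 14 0 ½`, the limit flow, the geometric tail `14·(½)^n∕(½)` and the two-sided logarithmic running in the continuum — part 6's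
`continuumCoupling_of_typedTheorem2` instantiated.  A toy of OURS∕prover 2's, not Bałaban's β. [cite: Balaban1987RG1, Thm 2 (0.31) p.259 with (0.20) p.256 and p.298] -/
theorem continuumLimit_typed_nonvacuous_signFree :
    ∃ (S : Setting) (hH : StandingHypotheses S), Definitions S ∧ Conclusions S ∧ Theorem2Statement S (hL_of_standing hH) ∧
      (∀ P : B12.RunParams, Step.InInterval (1 / 2) P.K (S.cpl P) → RGEqH P.K S.β (S.cpl P)) ∧
      HistLipschitz (fun k _ => if k = 1 then 5 * (1 / 2 : ℝ) else 0) (1 / 2) S.β ∧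
      FadingMemory (5 * (1 / 2) / (1 / 2)) (1 / 2) (fun k _ => if k = 1 then 5 * (1 / 2 : ℝ) else 0) ∧
      ScaleShiftRate (7 / 2) (1 / 2) (1 / 2) S.β ∧
      (∀ b γ : ℝ, 0 ≤ b → 0 < γ → ¬ BetaLowerH b γ S.β) ∧
      (¬ ∀ m : ℕ, ∃ γ₀ : ℝ, 0 < γ₀ ∧ ∀ γ : ℝ, 0 < γ → γ ≤ γ₀ → ∃ g₁ : ℝ, 0 < g₁ ∧ ∃ β β' : ℝ, 0 < β ∧ β ≤ β' ∧
        ∀ g : ℝ, 0 < g → g ≤ g₁ → ∀ K : ℕ, ∃ g₀ : ℝ, Step.InInterval γ K (S.cpl ⟨K, m, g₀⟩) ∧ S.cpl ⟨K, m, g₀⟩ K = g ∧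
          Step.Discrete031 (β * Real.log S.L) (β' * Real.log S.L) K g (S.cpl ⟨K, m, g₀⟩)) ∧
      ∀ m : ℕ, ∃ g₃ b b' : ℝ, 0 < g₃ ∧ 0 < b ∧ b ≤ b' ∧ ∀ gIR : ℝ, 0 < gIR → gIR ≤ g₃ →
        ∃ g₀ : ℕ → ℝ, (∀ K, Step.InInterval (1 / 2) K (S.cpl ⟨K, m, g₀ K⟩)) ∧ (∀ K, S.cpl ⟨K, m, g₀ K⟩ K = gIR) ∧
        InjectedRate (2 * (7 / 2) / (1 - 1 / 2)) 0 (1 / 2) (fun K j => disc (S.cpl ⟨K, m, g₀ K⟩) (S.cpl ⟨K + 1, m, g₀ (K + 1)⟩) j) ∧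
        (∀ m', Tendsto (fun n => S.cpl ⟨n + m', m, g₀ (n + m')⟩ n) atTop (𝓝 (gstar (fun K => S.cpl ⟨K, m, g₀ K⟩) m'))) ∧
        (∀ m', 0 < gstar (fun K => S.cpl ⟨K, m, g₀ K⟩) m' ∧ gstar (fun K => S.cpl ⟨K, m, g₀ K⟩) m' ≤ 1 / 2) ∧
        gstar (fun K => S.cpl ⟨K, m, g₀ K⟩) 0 = gIR ∧
        (∀ m', 1 / (gstar (fun K => S.cpl ⟨K, m, g₀ K⟩) (m' + 1)) ^ 2
          = 1 / (gstar (fun K => S.cpl ⟨K, m, g₀ K⟩) m') ^ 2 + bstar (fun K => S.cpl ⟨K, m, g₀ K⟩) m') ∧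
        (∀ m' n, |1 / (S.cpl ⟨n + m', m, g₀ (n + m')⟩ n) ^ 2 - 1 / (gstar (fun K => S.cpl ⟨K, m, g₀ K⟩) m') ^ 2|
          ≤ 2 * (7 / 2) / (1 - 1 / 2) * (1 / 2) ^ n / (1 - 1 / 2)) ∧
        (∀ m' : ℕ, 1 / (4 * gIR ^ 2) + b * (m' : ℝ) ≤ astar (fun K => S.cpl ⟨K, m, g₀ K⟩) m' ∧
          astar (fun K => S.cpl ⟨K, m, g₀ K⟩) m' ≤ 7 / (4 * gIR ^ 2) + b' * (m' : ℝ)) := by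
  obtain ⟨S, hH, hD, hC, hγ, hβ⟩ := rampToy_exists
  obtain ⟨-, -, -, hrg⟩ := letters_ramp hβ
  have hT := theorem2_typed_ramp hβ hH hD
  have hL := histLipschitz_ramp hβ (by norm_num : (0 : ℝ) ≤ 1 / 2)
  have hΛ := fadingMemory_ramp (γ := 1 / 2) (θ := 1 / 2) (by norm_num) (by norm_num) (by norm_num)
  have hS := scaleShiftRate_ramp hβ
  have hnolo : ∀ b γ : ℝ, 0 ≤ b → 0 < γ → ¬ BetaLowerH b γ S.β := fun b γ hb hγ0 hlo =>
    not_betaSignH_ramp hβ ⟨γ, hγ0, fun k v hv => hb.trans (hlo k v hv)⟩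
  exact ⟨S, hH, hD, hC, hT, hrg hD, hL, hΛ, hS, hnolo, not_uniform_ramp hβ hD (hL_of_standing hH).2,
    fun m => continuumCoupling_of_typedTheorem2 hT (by norm_num) (hrg hD) hS hL hΛ (by norm_num) (by norm_num) (by positivity)
      (by norm_num) m⟩

end

end Summit.QuantumFields.BalabanUV.Beta.EriceFlowEnclosureB12AsPrintedHistoryContagionShiftWitness
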